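import Summits.BirchSwinnertonDyer.BirchSwinnertonDyer.Theorems.TameQuarticManinParityALCutCongruenceWitnessOfDepthLaw
import HarnessLib

/-!
# Route `TameQuarticManinParity`, LINE 44 (bsd-idea-3 g12, crux line «al-cut-gap-one» on N42*′ stmt-BirchSwinnertonDyer-24103):
# N42*′ ⟸ «gap ≤ 1 between the Néron lattice and the AL cut along f on III*» ∧ DL3, and hence ⟸ gap-one ∧ desc's E-desc-23,
# BY NAME (`--supports` 24103; the gap-one law is spelled out as a hypothesis — it is the line's load-bearing stub, not a route item)

Cell `pub/bsd-wall`, D-0145 line `route-BirchSwinnertonDyer-TeichmullerTwistDescent`, seat `bsd-line-ttd-p1` g15.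
BSD is NOT proved by this; Manin's conjecture is not proved by this; N42*′ (`TprimeStarredNeronCongruenceDepth`, 24103), DL3
(24163) and the gap-one law stay OPEN. THEOREMS ONLY; the composition is the planner's kernel-checked `Line44.lean`
(`TprimeStarredNeronCongruenceDepth_of`: `t ↦ t/u`, `v₃(t/u) ≤ v₃ t + 1 ≤ 1 − v₃ deg φ`) with the stub inlined, followed by the
landed DL3 ⟸ E-desc-23 reduction (`tprimeALCutCongruenceWitnessAtThree_of_alStableDepthLaw`, p703875). Axioms `propext`,
`Classical.choice`, `Quot.sound`.
-/

set_option autoImplicit false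
-- D-0017: single-problem summit, so `Summit.BirchSwinnertonDyer.BirchSwinnertonDyer.…` repeats a namespace BY DESIGN.
set_option linter.dupNamespace false

noncomputable section

namespace Summit.BirchSwinnertonDyer.BirchSwinnertonDyer.Theorems.TameQuarticManinParity

open scoped MatrixGroups ModularForm
open CongruenceSubgroup
open Summit.BirchSwinnertonDyer.BirchSwinnertonDyer.Theses.TameQuarticManinParity
open Literature.NumberTheory.EllipticCurves Literature.NumberTheory.EllipticCurves.ModularForms
open Summit.BirchSwinnertonDyer.Rank1Residual.ManinAdditive

/-- **N42*′ from the gap-one law and DL3** (the LINE 44 composition, stub inlined): `⟨f,h⟩ = t⟨f,f⟩` (DL3, `v₃t ≤ −v₃ deg φ`)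
and `⟨f,h⟩ = u⟨f,g⟩` with `v₃u ≥ −1`, `g` cusp-regular rational (gap-one) give the witness `g`, `t/u`.
[cite: AbbesUllmo1996, Lemme 3.1] [cite: CesnaviciusNeururerSaha2023, Cor. 4.7, Thm. 5.15] -/
theorem tprimeStarredNeronCongruenceDepth_of_gapLeOne_of_alCutWitness
    (hGL : ∀ (W : WeierstrassCurve ℚ) [W.IsElliptic] [W.IsGloballyMinimal] [NeZero (W.conductorNorm ℤ)],
          Literature.NumberTheory.EllipticCurves.Rank1Residual.Addv W 3 →
          Summit.BirchSwinnertonDyer.Rank1Residual.Additive.SubTprime W 3 →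
          padicValInt 3 W.minimalDiscriminantInt = 9 →
          ∀ (D : ModularParametrizationData W (W.conductorNorm ℤ)),
          ∀ (M : Submodule ℤ (CuspForm (Gamma0 (W.conductorNorm ℤ)) 2)),
            M ≤ integralCuspForms0 (W.conductorNorm ℤ) 2 →
            (∀ p : ℕ, p.Prime → p ∣ W.conductorNorm ℤ →
              M.map ((atkinLehnerInvolutionAt (W.conductorNorm ℤ) 2 p).restrictScalars ℤ) ≤ M) →
          ∀ h ∈ M,
            ∃ g : CuspForm (Gamma0 (W.conductorNorm ℤ)) 2,
              (∀ n : ℕ, ∃ q : ℚ, (q : ℂ) = cuspCoeff g n) ∧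
              (∀ (γ : SL(2, ℤ)) (ι : PadicAlgCl 3 ≃+* ℂ) (n : ℕ),
                ‖ι.symm (fourierCoeffAtCusp (W.conductorNorm ℤ) 2 ⇑g γ n)‖ ≤
                  (3 : ℝ) ^ (((padicValNat 3 (W.conductorNorm ℤ) -
                      padicValNat 3 (cuspDenominator (W.conductorNorm ℤ) γ) : ℕ) : ℝ) -
                    cesnaviciusNeururerSahaCuspBound 3 (padicValNat 3 (cuspDenominator (W.conductorNorm ℤ) γ))
                      (padicValNat 3 (W.conductorNorm ℤ)))) ∧
              ∃ u : ℚ, -1 ≤ padicValRat 3 u ∧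
                peterssonProduct (Gamma0 (W.conductorNorm ℤ)) 2 D.f h =
                  (u : ℂ) * peterssonProduct (Gamma0 (W.conductorNorm ℤ)) 2 D.f g)
    (hDL : TprimeALCutCongruenceWitnessAtThree) : TprimeStarredNeronCongruenceDepth := by
  unfold TprimeStarredNeronCongruenceDepth
  intro W _ _ _ hadd hsub hΔ D hopt hmin
  haveI : Fact (Nat.Prime 3) := ⟨Nat.prime_three⟩
  obtain ⟨M, hMint, hMst, h, hh, t, ht0, htv, hfh⟩ := hDL W hadd hsub D hopt hmin
  obtain ⟨g, hgrat, hgreg, u, hu, hug⟩ := hGL W hadd hsub hΔ D M hMint hMst h hh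
  have hff : peterssonProduct (Gamma0 (W.conductorNorm ℤ)) 2 D.f D.f ≠ 0 := by
    intro h0
    have hpos := peterssonProduct_self_pos_holds (Gamma0 (W.conductorNorm ℤ)) 2
      (IsNormalized.ne_zero D.isNewformOf.1.2.2)
    rw [h0, Complex.zero_re] at hpos
    exact lt_irrefl _ hpos
  have hu0 : u ≠ 0 := by
    rintro rfl
    rw [hug, Rat.cast_zero, zero_mul] at hfh
    exact (mul_ne_zero (Rat.cast_ne_zero.mpr ht0) hff) hfh.symm
  refine ⟨g, hgrat, hgreg, t / u, div_ne_zero ht0 hu0, ?_, ?_⟩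
  · have : padicValRat 3 (t / u) = padicValRat 3 t - padicValRat 3 u := padicValRat.div ht0 hu0
    rw [this]
    have hδ : (0 : ℤ) ≤ padicValNat 3 D.modularDegree := by exact_mod_cast Nat.zero_le _
    linarith
  · have huC : (u : ℂ) ≠ 0 := Rat.cast_ne_zero.mpr hu0
    rw [Rat.cast_div, div_mul_eq_mul_div, eq_div_iff huC, ← hfh, hug, mul_comm]


/-- **N42*′ from the gap-one law and desc's E-desc-23** `ALStableDepthLaw` (DL3 discharged by p703875's reduction).
[cite: AgasheRibetStein2012, Thm. 2.1 (shape)] -/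
theorem tprimeStarredNeronCongruenceDepth_of_gapLeOne_of_alStableDepthLaw
    (hGL : ∀ (W : WeierstrassCurve ℚ) [W.IsElliptic] [W.IsGloballyMinimal] [NeZero (W.conductorNorm ℤ)],
          Literature.NumberTheory.EllipticCurves.Rank1Residual.Addv W 3 →
          Summit.BirchSwinnertonDyer.Rank1Residual.Additive.SubTprime W 3 →
          padicValInt 3 W.minimalDiscriminantInt = 9 →
          ∀ (D : ModularParametrizationData W (W.conductorNorm ℤ)),
          ∀ (M : Submodule ℤ (CuspForm (Gamma0 (W.conductorNorm ℤ)) 2)),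
            M ≤ integralCuspForms0 (W.conductorNorm ℤ) 2 →
            (∀ p : ℕ, p.Prime → p ∣ W.conductorNorm ℤ →
              M.map ((atkinLehnerInvolutionAt (W.conductorNorm ℤ) 2 p).restrictScalars ℤ) ≤ M) →
          ∀ h ∈ M,
            ∃ g : CuspForm (Gamma0 (W.conductorNorm ℤ)) 2,
              (∀ n : ℕ, ∃ q : ℚ, (q : ℂ) = cuspCoeff g n) ∧
              (∀ (γ : SL(2, ℤ)) (ι : PadicAlgCl 3 ≃+* ℂ) (n : ℕ),
                ‖ι.symm (fourierCoeffAtCusp (W.conductorNorm ℤ) 2 ⇑g γ n)‖ ≤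
                  (3 : ℝ) ^ (((padicValNat 3 (W.conductorNorm ℤ) -
                      padicValNat 3 (cuspDenominator (W.conductorNorm ℤ) γ) : ℕ) : ℝ) -
                    cesnaviciusNeururerSahaCuspBound 3 (padicValNat 3 (cuspDenominator (W.conductorNorm ℤ) γ))
                      (padicValNat 3 (W.conductorNorm ℤ)))) ∧
              ∃ u : ℚ, -1 ≤ padicValRat 3 u ∧
                peterssonProduct (Gamma0 (W.conductorNorm ℤ)) 2 D.f h =
                  (u : ℂ) * peterssonProduct (Gamma0 (W.conductorNorm ℤ)) 2 D.f g)
    (h23 : ALStableDepthLaw) : TprimeStarredNeronCongruenceDepth :=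
  tprimeStarredNeronCongruenceDepth_of_gapLeOne_of_alCutWitness hGL
    (tprimeALCutCongruenceWitnessAtThree_of_alStableDepthLaw h23)

end Summit.BirchSwinnertonDyer.BirchSwinnertonDyer.Theorems.TameQuarticManinParity

end
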